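import Literature.Geometry.Riemannian.EigenvaluePinchingSphere
import Literature.Geometry.Riemannian.VolumeSphereTheorem
import Literature.Geometry.Riemannian.BakryEmerySpectralGap
import Literature.Geometry.Riemannian.RicciFlowScalarCurvatureComparison
import Literature.Geometry.Lorentzian.PseudoRiemannianMetricProofs
import Literature.Geometry.Lorentzian.GreenIdentity
import HarnessLib

/-!
# Eigenvalue pinching `λₙ ≤ n + ε ⇒ M ≅ Sⁿ` (Aubry 2005, Théorème 1) — proofs file

Sibling of `Literature/Geometry/Riemannian/EigenvaluePinchingSphere.lean` (named fact
`aubry_diffeomorph_sphere_of_eigenvalue_pinching` = Aubry 2005, Théorème 1, Ann. Sci. ÉNS (4) 38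
(2005) 387–405, p. 388).

STATUS OF THE DISCHARGE. `aubry_diffeomorph_sphere_of_eigenvalue_pinching_holds` is NOT proved
here. The printed proof (p. 402: "la proposition suivante … combinée à la proposition 12 et au
théorème de J. Cheeger et T. Colding (cité en introduction) démontre le théorème 1") has three
layers:

1. **Proposition 19** (p. 402): `λₙ(M) ≤ n + ε ⇒ λₙ₊₁(M) ≤ n + C(n) ε^{1/2}` (Lemme 18, the
   Moser-iteration estimates of §2 with Ilias' explicit Sobolev inequality, and, in the
   non-orientable case, the equivariance/Smith-theory Lemmes 16–17);
2. **Proposition 12** (p. 395): `λₙ₊₁(M) ≤ n + ε ⇒ Vol M ≥ (1 − C(n) ε^{1/(2(n+1))}) Vol Sⁿ` (and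
   the eigenmap `Φ : M → Sⁿ` is a Hausdorff approximation of degree `±1`); the Remarque after
   Prop. 19 (p. 402) records the composite `λₙ(M) ≤ n + ε ⇒ Vol M ≥ (1 − C(n) ε^{β(n)}) Vol Sⁿ`;
3. **Cheeger–Colding 1997** (quoted p. 388; with the volume bound of layer 2 this is Appendix 1,
   Thm A.1.10 of J. Differential Geom. 46 (1997) 406–480 — the tree's named fact
   `CheegerColding1997_thmA110` of `VolumeSphereTheorem.lean`, itself undischarged) ⇒ `M ≅ Sⁿ`.

The uniform (in `n` only) analysis of layers 1–2 — Ilias' Sobolev constant under `Ric ≥ n − 1`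
(Lévy–Gromov isoperimetry), the Moser iteration of Lemme 11, Bishop–Gromov on the manifold
(Lemme 14), the mapping degree of `Φ` and the area formula, the orientation cover, the passage
min–max ↔ eigenfunctions — is not in Mathlib or `Literature/` at present, and layer 3 is an
undischarged fact.

WHAT IS PROVED.

§A. The assembly step of the printed proof, as a theorem with its two deep inputs as hypotheses:
`aubry_diffeomorph_sphere_of_eigenvalue_pinching_of_volume_pinching` — the named fact follows from
Cheeger–Colding's volume sphere theorem (`CheegerColding1997_thmA110`) together with Aubry's
spectral volume pinching (layers 1 + 2 in the qualitative form "for every `δ > 0` there is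
`ε(n, δ) > 0` with `λₙ ≤ n + ε ⇒ Vol M ≥ (1 − δ) Vol Sⁿ`", written in the eigenfunction
vocabulary of the fact and taken as a HYPOTHESIS `hV`, not vendored as a further named fact).

§B. **The `L²`-layer of §2 of the paper ("Lemme 8" in the language of functions), proved in
full.** Aubry works in Ruh's bundle `E = TM ⊕ ℝe` with the sections `S_f = ∇f + f e`; since
`D^E_Z S_f = ∇_Z∇f + f Z` (p. 391), `|D^E S_f|² = |Hess f + f g|²` and `|S_f|² = |∇f|² + f²`, so the
whole `L²`-theory of the `S_f` is a statement about `Hess f`, which we formalise directly with the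
tree's Levi-Civita calculus (`hessian`, `dalembertian`, `ricci`, `normSq`, `gradSq`):

* `PseudoRiemannianMetric.normSq_add_smul_toBilinForm` — `|T + c g|² = |T|² + 2c tr_g T + c² n`;
* `dalembertian_gradSq_eq` — **the Bochner formula on the manifold, with its Hessian term**:
  `Δ_g|∇u|² = 2|Hess u|² + 2 g⁻¹(du, dΔ_g u) + 2 Ric(∇u, ∇u)` for every `C^∞` metric (any model
  space) and smooth `u` (the coordinate identity `MetricCoord.IsMetricOn.lapAt_gradSqAt` of
  `CoordBochner.lean` read through the chart at the point: `normSq_hessian_chartInv_eq`,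
  `mfderiv_chartInv_sharpAt_eq`, `ricci_sharp_chartInv_eq`; the tree's
  `weightedBochner_pointwise_ge` is the inequality obtained by dropping `|Hess u|²`);
  `contMDiff_normSq_hessian` — `|Hess u|²_g` is smooth;
* on a closed Riemannian manifold modelled on `ℝᵐ` (the setting of `GreenIdentity.lean`):
  `integral_eq_zero_of_dalembertian_eq` (`Δu = −μu`, `μ ≠ 0 ⇒ ∫ u = 0`, p. 392),
  `integral_gradSq_eq_of_dalembertian_eq` (`∫|∇u|² = μ ∫u²`),
  `integral_normSq_hessian_add_integral_ricci_eq` — **the integrated Bochner formula**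
  `∫|Hess u|² + ∫ Ric(∇u,∇u) = ∫ (Δu)²` (Gallot–Hulin–Lafontaine, proof of Thm. 4.70),
  `mul_integral_gradSq_le_integral_ricci`, `integral_dalembertian_sq_eq`;
* `lichnerowicz_le_eigenvalue` — **Lichnerowicz's theorem `λ₁ ≥ n` under `Ric ≥ n − 1`**
  (Gallot–Hulin–Lafontaine 2004, Thm. 4.70; the bound "`n ≤ λ₁`" opening Aubry's §3, p. 395, and
  the Poincaré step "Or `λ₁ ≥ n`" of the degree computation, p. 398);
* `aubry_integral_normSq_hessian_add_smul_le` — **Aubry's `L²`-estimate**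
  `‖D^E S_u‖₂² = ∫|Hess u + u g|² ≤ (μ − n)(μ − 1) ∫u²` for an eigenfunction `Δu = −μu` under
  `Ric ≥ n − 1` (Lemme 8 with the first inequality of Prop. 10 (ii); the input
  "`‖D^E Sᵢ‖₂² ≤ C(n)ε`" of p. 398 and of Lemme 18, p. 401);
* `aubry_eigenfunction_estimates` — the three conclusions `∫ f = 0`, `n ≤ μ`,
  `∫|Hess f + f g|² ≤ ε(n + ε − 1)` for ONE normalised eigenfunction with `0 < μ ≤ n + ε`, in the
  exact binders of the named fact; `aubry_sections_L2_orthogonal` — `⟨Sᵢ, Sⱼ⟩_{L²} = (μⱼ + 1) δᵢⱼ`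
  for the fact's `L²`-orthonormal family of eigenfunctions (p. 394);
* `aubry_abs_degree_eq_one_of_volume` — the closing arithmetic of Prop. 12 (p. 398): an integer
  `d` and volumes `0 < V ≤ V₀` with `| |d| V₀/V − 1 | ≤ η < 1` have `|d| = 1` and `V₀ ≤ (1 + η) V`;
* `linearIndependent_of_abs_bilin_sub_delta_le`, `card_le_finrank_of_abs_bilin_sub_delta_le` — the
  rank argument closing §2 (p. 395, giving Prop. 10 (i)): `k` vectors with `|B(Sᵢ, Sⱼ) − δᵢⱼ| ≤ η`,
  `kη < 1`, are linearly independent, so `k ≤ dim`.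

Not yet formalised from §2: the `L^∞`-estimate Lemme 11 (i) (Moser iteration, which needs the
`n`-uniform Sobolev inequality of Ilias [14]) and Lemme 11 (ii).

## References

* E. Aubry, *Pincement sur le spectre et le volume en courbure de Ricci positive*, Ann. Sci.
  École Norm. Sup. (4) 38 (2005) 387–405: Théorème 1 (p. 388), §2 Lemme 8–11 and Prop. 10
  (pp. 391–395), Proposition 12 (p. 395), p. 398, Proposition 19 and the Remarque following it
  (p. 402). [Aubry2005]
* J. Cheeger, T. H. Colding, *On the structure of spaces with Ricci curvature bounded below. I*,
  J. Differential Geom. 46 (1997) 406–480, Appendix 1, Thm A.1.10 (p. 459). [CheegerColding1997]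
* S. Gallot, D. Hulin, J. Lafontaine, *Riemannian Geometry*, 3rd ed., Universitext, Springer
  2004, §4.G.4, Thm. 4.70 (Lichnerowicz) and its proof (integrated Bochner formula).
  [GallotHulinLafontaine2004]
* P. Topping, *Lectures on the Ricci flow*, LMS Lecture Note Series 325, CUP 2006, proof of
  Prop. 8.2.6 (Bochner formula). [Topping2006]
-/

noncomputable section

open MeasureTheory
open scoped Manifold ContDiff

namespace Literature.Geometry.Riemannian

open Literature.Geometry.Lorentzian (PseudoRiemannianMetric riemannianMeasure)
open Literature.Geometry.Lorentzian.PseudoRiemannianMetric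

/-- **Assembly of Aubry 2005, Théorème 1** (p. 402: "proposition 19 … combinée à la
proposition 12 et au théorème de J. Cheeger et T. Colding … démontre le théorème 1"). The named
fact `aubry_diffeomorph_sphere_of_eigenvalue_pinching` follows from

* `hCC` : Cheeger–Colding's differentiable volume sphere theorem (`CheegerColding1997_thmA110`,
  J. Differential Geom. 46 (1997), App. 1, Thm A.1.10: `Ric ≥ n − 1`, `Vol M ≥ (1 − δ(n)) Vol Sⁿ`
  `⇒ M ≅ Sⁿ`), and
* `hV` : Aubry's spectral volume pinching, Proposition 19 + Proposition 12 (Remarque p. 402: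
  `λₙ(M) ≤ n + ε ⇒ Vol M ≥ (1 − C(n) ε^{β(n)}) Vol Sⁿ`), in the qualitative form: for every
  `n ≥ 2` and `δ > 0` there is `ε > 0` such that a closed connected Riemannian `n`-manifold with
  `Ric ≥ n − 1` carrying `n` `L²(dv_g)`-orthonormal eigenfunctions `tr_g Hess fᵢ = −μᵢ fᵢ`,
  `0 < μᵢ ≤ n + ε`, has `riemannianMeasure g univ ≥ (1 − δ) |Sⁿ|` (`|Sⁿ| = unitSphereVolume n`).

Given `n ≥ 2`, take `δ(n)` from `hCC`, then `ε(n, δ(n))` from `hV`; a manifold satisfying the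
eigenvalue pinching with this `ε` has almost maximal volume, hence is diffeomorphic to `Sⁿ`.
[cite: Aubry2005, Théorème 1 (p. 388) via Prop. 12 (p. 395), Prop. 19 (p. 402)] -/
theorem aubry_diffeomorph_sphere_of_eigenvalue_pinching_of_volume_pinching
    (hCC : CheegerColding1997_thmA110)
    (hV : ∀ (n : ℕ), 2 ≤ n → ∀ δ : ℝ, 0 < δ → ∃ ε : ℝ, 0 < ε ∧
      ∀ (M : Type) [TopologicalSpace M] [T2Space M] [SecondCountableTopology M]
        [ChartedSpace (EuclideanSpace ℝ (Fin n)) M] [IsManifold (𝓡 n) ∞ M] [CompactSpace M]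
        [ConnectedSpace M] [T3Space M] [MeasurableSpace M] [BorelSpace M]
        (g : Bundle.ContMDiffRiemannianMetric (𝓡 n) ∞ (EuclideanSpace ℝ (Fin n))
          (TangentSpace (𝓡 n) : M → Type _))
        (_ : (ofRiemannian g).HasLeviCivita) (f : Fin n → M → ℝ) (μ : Fin n → ℝ),
        (∀ (x : M) (v : TangentSpace (𝓡 n) x),
            ((n : ℝ) - 1) * g.inner x v v ≤ (ofRiemannian g).ricci x v v) →
        (∀ i, ContMDiff (𝓡 n) 𝓘(ℝ, ℝ) ∞ (f i)) →
        (∀ (i : Fin n) (x : M), (ofRiemannian g).dalembertian (f i) x = -(μ i) * f i x) →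
        (∀ i, 0 < μ i ∧ μ i ≤ n + ε) →
        (∀ i j, ∫ x, f i x * f j x ∂(riemannianMeasure g) = if i = j then 1 else 0) →
        ENNReal.ofReal ((1 - δ) * unitSphereVolume n) ≤ riemannianMeasure g Set.univ) :
    aubry_diffeomorph_sphere_of_eigenvalue_pinching := by
  intro n hn
  obtain ⟨δ, hδ, H⟩ := hCC n hn
  obtain ⟨ε, hε, HV⟩ := hV n hn δ hδ
  refine ⟨ε, hε, ?_⟩
  intro M _ _ _ _ _ _ _ _ _ _ g hLC f μ hRic hf hΔ hμ horth
  exact H M g hRic (HV M g hLC f μ hRic hf hΔ hμ horth)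

end Literature.Geometry.Riemannian

/-! ## Part B — the `L²`-layer of Aubry's §2 ("Lemme 8" for functions) -/

open Bundle Set Function Module Filter Manifold
open scoped Topology

namespace Literature.Geometry.Lorentzian.PseudoRiemannianMetric

section NormSqAlgebra

variable {EB : Type*} [NormedAddCommGroup EB] [NormedSpace ℝ EB] {HB : Type*} [TopologicalSpace HB]
  {IB : ModelWithCorners ℝ EB HB} {n : WithTop ℕ∞}
  {B : Type*} [TopologicalSpace B] [ChartedSpace HB B]
  {F : Type*} [NormedAddCommGroup F] [NormedSpace ℝ F]
  {E : B → Type*} [TopologicalSpace (TotalSpace F E)]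
  [∀ b, TopologicalSpace (E b)] [∀ b, AddCommGroup (E b)] [∀ b, Module ℝ (E b)]
  [FiberBundle F E] [VectorBundle ℝ F E] [FiniteDimensional ℝ F]

/-- **`|T + c g|²_g = |T|²_g + 2c tr_g T + c² dim`** for a symmetric bilinear form `T` on a fibre
and a real `c` (expand `tr ((♯T + c id)²)`, `♯ ∘ g = id`). O'Neill 1983, Ch. 3, pp. 60–61 and
Exercise 10 (a). [cite: ONeill1983, Ch. 3, pp. 60–61] -/
theorem normSq_add_smul_toBilinForm (g : PseudoRiemannianMetric IB n F E) (b : B)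
    {T : LinearMap.BilinForm ℝ (E b)} (hT : ∀ v w, T v w = T w v) (c : ℝ) :
    g.normSq b (T + c • g.toBilinForm b) =
      g.normSq b T + 2 * c * g.trace b T + c ^ 2 * Module.finrank ℝ F := by
  haveI := VectorBundle.finiteDimensional ℝ F E b
  set A : E b →ₗ[ℝ] E b := (g.sharp b).toLinearMap ∘ₗ T with hA
  have hTflip : T.flip = T := by
    ext v w
    exact hT w v
  have hflip : (T + c • g.toBilinForm b).flip = T + c • g.toBilinForm b := by
    ext v w
    change (T + c • g.toBilinForm b) w v = (T + c • g.toBilinForm b) v w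
    simp only [LinearMap.add_apply, LinearMap.smul_apply, toBilinForm_apply, hT w v, g.symm b w v]
  have hcomp : (g.sharp b).toLinearMap ∘ₗ (T + c • g.toBilinForm b) = A + c • LinearMap.id := by
    rw [LinearMap.comp_add, LinearMap.comp_smul, sharp_comp_toBilinForm]
  have hn : LinearMap.trace ℝ (E b) LinearMap.id = (Module.finrank ℝ F : ℝ) := by
    rw [LinearMap.trace_id, VectorBundle.finrank_eq ℝ F E b]
  have h1 : g.normSq b (T + c • g.toBilinForm b) =
      LinearMap.trace ℝ (E b) ((A + c • LinearMap.id) ∘ₗ (A + c • LinearMap.id)) := by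
    rw [normSq, hflip, hcomp]
  have h2 : g.normSq b T = LinearMap.trace ℝ (E b) (A ∘ₗ A) := by
    rw [normSq, hTflip]
  have h3 : g.trace b T = LinearMap.trace ℝ (E b) A := rfl
  rw [h1, h2, h3]
  simp only [LinearMap.comp_add, LinearMap.add_comp, LinearMap.comp_smul, LinearMap.smul_comp,
    LinearMap.comp_id, LinearMap.id_comp, map_add, map_smul, smul_eq_mul, hn, smul_add]
  ring

end NormSqAlgebra

end Literature.Geometry.Lorentzian.PseudoRiemannianMetric

namespace Literature.Geometry.Riemannian

open Lorentzian Lorentzian.PseudoRiemannianMetric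

section Pointwise

variable {E : Type*} [NormedAddCommGroup E] [NormedSpace ℝ E] [FiniteDimensional ℝ E]
  {H : Type*} [TopologicalSpace H] {I : ModelWithCorners ℝ E H} [I.Boundaryless]
  {M : Type*} [TopologicalSpace M] [ChartedSpace H M] [IsManifold I ∞ M]
  (g : PseudoRiemannianMetric I ∞ E (TangentSpace I : M → Type _)) [g.HasLeviCivita]

/-- **`|Hess F|²_g` read in the chart**: `|Hess F|²_g (Φ u) = |Hess_G F̂|²_G (u)` for `F` of class
`C²` at `Φ u` (naturality of the Hessian and of the metric square norm, `hessian_comap_apply`,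
`normSq_comap_eq`, and the chart identities `OpensChart.hessian_eq_hessAt`,
`OpensChart.normSq_eq_normSqAt`). [cite: ONeill1983, Ch. 3, Prop. 3.59] -/
theorem normSq_hessian_chartInv_eq (x₀ : M) (u : chartTarget I x₀) {F : M → ℝ}
    (hF : ContMDiffAt I 𝓘(ℝ, ℝ) 2 F (chartInv I x₀ u)) :
    g.normSq (chartInv I x₀ u) (g.hessian F (chartInv I x₀ u)) =
      MetricCoord.normSqAt (chartRep I (fun _ ↦ g) x₀ 0) u
        (MetricCoord.hessAt (chartRep I (fun _ ↦ g) x₀ 0) (F ∘ (extChartAt I x₀).symm) u) := by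
  haveI := (chartPullback I g x₀).hasLeviCivita
  have hG := val_chartPullback_eq_chartRep (fun _ : ℝ ↦ g) x₀ 0
  have hrep : ContDiffAt ℝ 2 (F ∘ (extChartAt I x₀).symm) (u : E) := by
    have hsymm : ContMDiffAt 𝓘(ℝ, E) I 2 (extChartAt I x₀).symm (u : E) :=
      (contMDiffOn_extChartAt_symm x₀).contMDiffAt
        ((isOpen_extChartAt_target x₀).mem_nhds u.2)
    exact contMDiffAt_iff_contDiffAt.1 (hF.comp (u : E) hsymm)
  have h1 : (chartPullback I g x₀).normSq u ((chartPullback I g x₀).hessian (F ∘ chartInv I x₀) u) =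
      g.normSq (chartInv I x₀ u) (g.hessian F (chartInv I x₀ u)) :=
    normSq_chartPullback_eq g x₀ u _ _ (fun v w ↦
      g.hessian_comap_apply contMDiff_pullbackBilin_holds (contMDiff_chartInv x₀)
        (injective_mfderiv_chartInv x₀) rfl hF v w)
  rw [← h1]
  exact Lorentzian.OpensChart.normSq_eq_normSqAt hG u _ _
    (fun v w ↦ Lorentzian.OpensChart.hessian_eq_hessAt hG u (f := F ∘ chartInv I x₀)
      (fun _ ↦ rfl) hrep v w)

omit [g.HasLeviCivita] in
/-- **The gradient read in the chart**: `dΦ_u (♯_G DF̂(u)) = ♯_g dF (Φ u)` — the coordinate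
gradient `♯_{G(u)} DF̂(u)` of the representative is carried by `dΦ_u` to the gradient of `F`
(naturality of `♯`, `sharp_comap_mfderiv_apply`, the chain rule, and `OpensChart.sharp_eq_sharpAt`).
[cite: ONeill1983, Ch. 3, p. 60 and Prop. 3.59] -/
theorem mfderiv_chartInv_sharpAt_eq (x₀ : M) (u : chartTarget I x₀) {F : M → ℝ}
    (hF : MDifferentiableAt I 𝓘(ℝ, ℝ) F (chartInv I x₀ u)) :
    mfderiv 𝓘(ℝ, E) I (chartInv I x₀) u
        (MetricCoord.sharpAt (chartRep I (fun _ ↦ g) x₀ 0) u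
          (fderiv ℝ (F ∘ (extChartAt I x₀).symm) u)) =
      g.sharp (chartInv I x₀ u)
        (mvfderiv I F (chartInv I x₀ u) : TangentSpace I (chartInv I x₀ u) →ₗ[ℝ] ℝ) := by
  have hG := val_chartPullback_eq_chartRep (fun _ : ℝ ↦ g) x₀ 0
  have hΦu : MDifferentiableAt 𝓘(ℝ, E) I (chartInv I x₀) u :=
    ((contMDiff_chartInv x₀).of_le le_add_self u).mdifferentiableAt one_ne_zero
  -- the chain rule `d(F ∘ Φ)_u = dF_{Φ u} ∘ dΦ_u`
  have hchain : (mvfderiv 𝓘(ℝ, E) (F ∘ chartInv I x₀) u :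
      TangentSpace 𝓘(ℝ, E) u →ₗ[ℝ] ℝ) =
      (mvfderiv I F (chartInv I x₀ u) : TangentSpace I (chartInv I x₀ u) →ₗ[ℝ] ℝ) ∘ₗ
        (mfderiv 𝓘(ℝ, E) I (chartInv I x₀) u).toLinearMap := by
    ext v
    exact mvfderiv_comp_apply hF hΦu v
  -- `♯_G DF̂(u) = ♯_{Φ^*g} d(F ∘ Φ)_u`
  have hsharp : MetricCoord.sharpAt (chartRep I (fun _ ↦ g) x₀ 0) u
      (fderiv ℝ (F ∘ (extChartAt I x₀).symm) u) =
      (chartPullback I g x₀).sharp u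
        (mvfderiv 𝓘(ℝ, E) (F ∘ chartInv I x₀) u : TangentSpace 𝓘(ℝ, E) u →ₗ[ℝ] ℝ) := by
    rw [mvfderiv_comp_chartInv_toLinearMap x₀ u hF]
    exact (Lorentzian.OpensChart.sharp_eq_sharpAt hG u _).symm
  rw [hsharp, hchain]
  change mfderiv 𝓘(ℝ, E) I (chartInv I x₀) u
      ((g.comap contMDiff_pullbackBilin_holds (chartInv I x₀) (contMDiff_chartInv x₀)
        (injective_mfderiv_chartInv x₀) rfl).sharp u
        ((mvfderiv I F (chartInv I x₀ u) : TangentSpace I (chartInv I x₀ u) →ₗ[ℝ] ℝ) ∘ₗ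
          (mfderiv 𝓘(ℝ, E) I (chartInv I x₀) u).toLinearMap)) = _
  rw [g.sharp_comap_mfderiv_apply contMDiff_pullbackBilin_holds (contMDiff_chartInv x₀)
    (injective_mfderiv_chartInv x₀) rfl u]
  exact mfderiv_mfderivEquivOfInjective_symm (I := I) (I' := 𝓘(ℝ, E)) (chartInv I x₀) u
    (injective_mfderiv_chartInv x₀ u) rfl _

/-- **`Ric(∇F, ∇F)` read in the chart**: `Ric_g(♯dF, ♯dF)(Φ u) = Ric_G(♯_G DF̂, ♯_G DF̂)(u)`
(`ricci_comap_apply`, `OpensChart.ricci_eq_ricAt`, `mfderiv_chartInv_sharpAt_eq`).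
[cite: ONeill1983, Ch. 3, Prop. 3.59] -/
theorem ricci_sharp_chartInv_eq (x₀ : M) (u : chartTarget I x₀) {F : M → ℝ}
    (hF : MDifferentiableAt I 𝓘(ℝ, ℝ) F (chartInv I x₀ u)) :
    g.ricci (chartInv I x₀ u)
        (g.sharp (chartInv I x₀ u)
          (mvfderiv I F (chartInv I x₀ u) : TangentSpace I (chartInv I x₀ u) →ₗ[ℝ] ℝ))
        (g.sharp (chartInv I x₀ u)
          (mvfderiv I F (chartInv I x₀ u) : TangentSpace I (chartInv I x₀ u) →ₗ[ℝ] ℝ)) =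
      MetricCoord.ricAt (chartRep I (fun _ ↦ g) x₀ 0) u
        (MetricCoord.sharpAt (chartRep I (fun _ ↦ g) x₀ 0) u
          (fderiv ℝ (F ∘ (extChartAt I x₀).symm) u))
        (MetricCoord.sharpAt (chartRep I (fun _ ↦ g) x₀ 0) u
          (fderiv ℝ (F ∘ (extChartAt I x₀).symm) u)) := by
  haveI := (chartPullback I g x₀).hasLeviCivita
  have hG := val_chartPullback_eq_chartRep (fun _ : ℝ ↦ g) x₀ 0
  rw [← Lorentzian.OpensChart.ricci_eq_ricAt hG u,
    g.ricci_comap_apply contMDiff_pullbackBilin_holds (contMDiff_chartInv x₀)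
      (injective_mfderiv_chartInv x₀) rfl u,
    mfderiv_chartInv_sharpAt_eq g x₀ u hF]

/-- **The Bochner formula on a pseudo-Riemannian manifold** (pointwise, with the Hessian term):
for a `C^∞` metric `g` with its Levi-Civita connection, a `C^∞` function `u` and every `x`,

  `Δ_g |∇u|² (x) = 2 |Hess u|²_g (x) + 2 g⁻¹(du, d(Δ_g u))(x) + 2 Ric(∇u, ∇u)(x)`,

`Δ_g = tr_g Hess` (`dalembertian`), `|∇u|² = g⁻¹(du, du)` (`gradSq`), `|Hess u|²_g = normSq (hessian u)`,
`∇u = ♯ du`. Proof: the coordinate Bochner formula `MetricCoord.IsMetricOn.lapAt_gradSqAt`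
(Topping 2006, proof of Prop. 8.2.6; Petersen, *Riemannian Geometry*, the Bochner formula) in the
chart at `x`, every term being read through the chart (`dalembertian_chartInv_eq`,
`innerDual_chartInv_eq`, `normSq_hessian_chartInv_eq`, `ricci_sharp_chartInv_eq`).
[cite: Topping2006, proof of Prop. 8.2.6 (Bochner formula)] -/
theorem dalembertian_gradSq_eq {u : M → ℝ} (hu : ContMDiff I 𝓘(ℝ, ℝ) ∞ u) (x : M) :
    g.dalembertian (g.gradSq u) x =
      2 * g.normSq x (g.hessian u x)
        + 2 * g.innerDual x (mvfderiv I u x : TangentSpace I x →ₗ[ℝ] ℝ)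
            (mvfderiv I (g.dalembertian u) x : TangentSpace I x →ₗ[ℝ] ℝ)
        + 2 * g.ricci x (g.sharp x (mvfderiv I u x : TangentSpace I x →ₗ[ℝ] ℝ))
            (g.sharp x (mvfderiv I u x : TangentSpace I x →ₗ[ℝ] ℝ)) := by
  -- the chart at `x`, components and representatives
  set G := chartRep I (fun _ ↦ g) x 0 with hGdef
  have hGm : MetricCoord.IsMetricOn G (extChartAt I x).target :=
    Lorentzian.OpensChart.isMetricOn_repr (val_chartPullback_eq_chartRep (fun _ : ℝ ↦ g) x 0)
  set uh : E → ℝ := u ∘ (extChartAt I x).symm with huhdef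
  have hu0 : extChartAt I x x ∈ (extChartAt I x).target := mem_extChartAt_target x
  set u₀ : chartTarget I x := ⟨extChartAt I x x, hu0⟩ with hu₀def
  have hΦu₀ : chartInv I x u₀ = x := extChartAt_to_inv x
  have huh : ContDiffOn ℝ ∞ uh (extChartAt I x).target := by
    rw [huhdef, ← contMDiffOn_iff_contDiffOn]
    exact hu.comp_contMDiffOn (contMDiffOn_extChartAt_symm x)
  -- the coordinate Bochner formula at `φ x`
  have key := hGm.lapAt_gradSqAt hu0 huh
  -- regularity of the manifold-level functions
  have hud : ∀ y, MDifferentiableAt I 𝓘(ℝ, ℝ) u y := fun y ↦ hu.mdifferentiableAt (by simp)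
  have hu2 : ∀ y, ContMDiffAt I 𝓘(ℝ, ℝ) 2 u y := fun y ↦
    (hu.of_le (WithTop.coe_le_coe.mpr le_top)).contMDiffAt
  have hQ : ContMDiff I 𝓘(ℝ, ℝ) ∞ (g.gradSq u) := contMDiff_gradSq g hu
  have hQ2 : ContMDiffAt I 𝓘(ℝ, ℝ) 2 (g.gradSq u) (chartInv I x u₀) :=
    (hQ.of_le (WithTop.coe_le_coe.mpr le_top)).contMDiffAt
  have hLs : ContMDiff I 𝓘(ℝ, ℝ) ∞ (g.dalembertian u) := contMDiff_dalembertian g hu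
  have hLd : ∀ y, MDifferentiableAt I 𝓘(ℝ, ℝ) (g.dalembertian u) y := fun y ↦
    hLs.mdifferentiableAt (by simp)
  -- (a) `|∇u|²` read in the chart (as a function near `φ x`)
  have hQrep : (g.gradSq u ∘ (extChartAt I x).symm) =ᶠ[𝓝 (extChartAt I x x)]
      MetricCoord.gradSqAt G uh := by
    filter_upwards [(isOpen_extChartAt_target x).mem_nhds hu0] with z hz
    exact gradSq_chartInv_eq g x ⟨z, hz⟩ (hud _)
  -- (b) `Δ|∇u|²`
  have hlap : g.dalembertian (g.gradSq u) x =
      MetricCoord.lapAt G (MetricCoord.gradSqAt G uh) (extChartAt I x x) := by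
    have h := dalembertian_chartInv_eq g x u₀ hQ2
    rw [hΦu₀] at h
    rw [h]
    exact MetricCoord.lapAt_congr_of_eventuallyEq G hQrep
  -- (c) `g⁻¹(du, d(Δu))`: the representative of `Δu` near `φ x` is `lapAt G uh`
  have hLrep : (g.dalembertian u ∘ (extChartAt I x).symm) =ᶠ[𝓝 (extChartAt I x x)]
      MetricCoord.lapAt G uh := by
    filter_upwards [(isOpen_extChartAt_target x).mem_nhds hu0] with z hz
    have h1 := dalembertian_chartInv_eq g x ⟨z, hz⟩ (hu2 _)
    simp only [chartInv_apply] at h1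
    simp only [Function.comp_apply]
    exact h1
  have hIL : g.innerDual x (mvfderiv I u x : TangentSpace I x →ₗ[ℝ] ℝ)
      (mvfderiv I (g.dalembertian u) x : TangentSpace I x →ₗ[ℝ] ℝ) =
      fderiv ℝ (MetricCoord.lapAt G uh) (extChartAt I x x)
        (MetricCoord.sharpAt G (extChartAt I x x) (fderiv ℝ uh (extChartAt I x x))) := by
    have h := innerDual_chartInv_eq g x u₀ (hud _) (hLd _)
    rw [hΦu₀] at h
    rw [h, MetricCoord.apply_sharpAt_comm (hGm.isInvertible _ hu0) (hGm.symm _ hu0),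
      hLrep.fderiv_eq]
  -- (d) `|Hess u|²`
  have hN : g.normSq x (g.hessian u x) =
      MetricCoord.normSqAt G (extChartAt I x x) (MetricCoord.hessAt G uh (extChartAt I x x)) := by
    have h := normSq_hessian_chartInv_eq g x u₀ (hu2 _)
    rw [hΦu₀] at h
    exact h
  -- (e) `Ric(∇u, ∇u)`
  have hR : g.ricci x (g.sharp x (mvfderiv I u x : TangentSpace I x →ₗ[ℝ] ℝ))
      (g.sharp x (mvfderiv I u x : TangentSpace I x →ₗ[ℝ] ℝ)) =
      MetricCoord.ricAt G (extChartAt I x x)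
        (MetricCoord.sharpAt G (extChartAt I x x) (fderiv ℝ uh (extChartAt I x x)))
        (MetricCoord.sharpAt G (extChartAt I x x) (fderiv ℝ uh (extChartAt I x x))) := by
    have h := ricci_sharp_chartInv_eq g x u₀ (hud _)
    rw [hΦu₀] at h
    exact h
  rw [hlap, hIL, hN, hR]
  exact key

omit [g.HasLeviCivita] in
/-- **`|Hess F|²_g` is smooth for smooth `F`** (read in each chart it is
`normSqAt G (hessAt G F̂) ∘ φ`, `IsMetricOn.contDiffOn_normSqAt`, `IsMetricOn.contDiffOn_hessAt`).
[folklore] -/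
theorem contMDiff_normSq_hessian [g.HasLeviCivita] {F : M → ℝ} (hF : ContMDiff I 𝓘(ℝ, ℝ) ∞ F) :
    ContMDiff I 𝓘(ℝ, ℝ) ∞ (fun y ↦ g.normSq y (g.hessian F y)) := by
  intro x₀
  set G := chartRep I (fun _ ↦ g) x₀ 0 with hGdef
  have hGm : MetricCoord.IsMetricOn G (extChartAt I x₀).target :=
    Lorentzian.OpensChart.isMetricOn_repr (val_chartPullback_eq_chartRep (fun _ : ℝ ↦ g) x₀ 0)
  have hFrep : ContDiffOn ℝ ∞ (F ∘ (extChartAt I x₀).symm) (extChartAt I x₀).target := by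
    rw [← contMDiffOn_iff_contDiffOn]
    exact hF.comp_contMDiffOn (contMDiffOn_extChartAt_symm x₀)
  have hN : ContDiffOn ℝ ∞ (fun y ↦ MetricCoord.normSqAt G y
      (MetricCoord.hessAt G (F ∘ (extChartAt I x₀).symm) y)) (extChartAt I x₀).target :=
    hGm.contDiffOn_normSqAt (hGm.contDiffOn_hessAt hFrep)
  have heq : ∀ y ∈ (chartAt H x₀).source, g.normSq y (g.hessian F y) =
      MetricCoord.normSqAt G (extChartAt I x₀ y)
        (MetricCoord.hessAt G (F ∘ (extChartAt I x₀).symm) (extChartAt I x₀ y)) := by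
    intro y hy
    have hu : extChartAt I x₀ y ∈ (extChartAt I x₀).target :=
      (extChartAt I x₀).map_source (by rwa [extChartAt_source])
    have h := normSq_hessian_chartInv_eq g x₀ ⟨extChartAt I x₀ y, hu⟩ (F := F)
      (by rw [chartInv_extChartAt x₀ hy]; exact (hF.of_le (WithTop.coe_le_coe.mpr le_top)).contMDiffAt)
    rw [chartInv_extChartAt x₀ hy] at h
    exact h
  have hcomp : ContMDiffOn I 𝓘(ℝ, ℝ) ∞
      (fun y ↦ MetricCoord.normSqAt G (extChartAt I x₀ y)
        (MetricCoord.hessAt G (F ∘ (extChartAt I x₀).symm) (extChartAt I x₀ y)))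
      (chartAt H x₀).source := by
    have h1 : ContMDiffOn 𝓘(ℝ, E) 𝓘(ℝ, ℝ) ∞ (fun y ↦ MetricCoord.normSqAt G y
        (MetricCoord.hessAt G (F ∘ (extChartAt I x₀).symm) y)) (extChartAt I x₀).target :=
      contMDiffOn_iff_contDiffOn.2 hN
    refine h1.comp (contMDiffOn_extChartAt (n := ∞)) fun y hy ↦ ?_
    exact (extChartAt I x₀).map_source (by rwa [extChartAt_source])
  have hsrc : (chartAt H x₀).source ∈ 𝓝 x₀ :=
    (chartAt H x₀).open_source.mem_nhds (mem_chart_source H x₀)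
  refine ((hcomp.contMDiffAt hsrc).congr_of_eventuallyEq ?_)
  filter_upwards [hsrc] with y hy
  exact heq y hy

end Pointwise

/-! ### Integrated consequences on a closed Riemannian manifold -/

section Integrated

variable {m : ℕ} {H : Type*} [TopologicalSpace H]
  {I : ModelWithCorners ℝ (EuclideanSpace ℝ (Fin m)) H} [I.Boundaryless]
  {N : Type*} [TopologicalSpace N] [ChartedSpace H N] [IsManifold I ∞ N] [CompactSpace N]
  [T2Space N] [MeasurableSpace N] [BorelSpace N]
  (h : ContMDiffRiemannianMetric I ∞ (EuclideanSpace ℝ (Fin m)) (TangentSpace I : N → Type _))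
  [(ofRiemannian h).HasLeviCivita]

/-- **Eigenfunctions of nonzero eigenvalue have mean zero**: on a closed Riemannian manifold, if
`f ∈ C²` satisfies `Δ_h f = −μ f` with `μ ≠ 0`, then `∫ f dμ_h = 0` (`∫ Δ_h f = 0`,
`integral_dalembertian_eq_zero`). Aubry 2005, p. 392 ("Les fonctions de `F` sont d'intégrale
nulle"). [cite: Aubry2005, §2, proof of Prop. 10 (p. 392)] -/
theorem integral_eq_zero_of_dalembertian_eq {f : N → ℝ} {μ : ℝ} (hf : CMDiff 2 f)
    (hΔ : ∀ x, (ofRiemannian h).dalembertian f x = -μ * f x) (hμ : μ ≠ 0) :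
    ∫ x, f x ∂riemannianMeasure h = 0 := by
  have h0 := integral_dalembertian_eq_zero h hf
  simp_rw [hΔ] at h0
  rw [integral_const_mul, mul_eq_zero] at h0
  exact h0.resolve_left (neg_ne_zero.mpr hμ)

/-- **The Dirichlet energy of an eigenfunction**: if `f ∈ C²` satisfies `Δ_h f = −μ f` on a closed
Riemannian manifold then `∫ h⁻¹(df, df) dμ_h = μ ∫ f² dμ_h` (Green's identity
`∫ f Δ_h f = −∫ h⁻¹(df, df)`). Aubry 2005, §2 (the normalisation `‖∇fᵢ‖₂² = λᵢ‖fᵢ‖₂²` behind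
"`(Sᵢ/√(λᵢ+1))` est `L²`-orthonormée", p. 394). [cite: Aubry2005, §2 (p. 394)] -/
theorem integral_gradSq_eq_of_dalembertian_eq {f : N → ℝ} {μ : ℝ} (hf : CMDiff 2 f)
    (hΔ : ∀ x, (ofRiemannian h).dalembertian f x = -μ * f x) :
    ∫ x, (ofRiemannian h).gradSq f x ∂riemannianMeasure h =
      μ * ∫ x, f x ^ 2 ∂riemannianMeasure h := by
  have hG := integral_mul_dalembertian_eq_neg_integral_innerDual h (hf.of_le one_le_two) hf
  simp_rw [hΔ] at hG
  have h1 : ∫ x, f x * (-μ * f x) ∂riemannianMeasure h = -μ * ∫ x, f x ^ 2 ∂riemannianMeasure h := by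
    rw [← integral_const_mul]
    refine integral_congr_ae (Eventually.of_forall fun x ↦ ?_)
    ring
  rw [h1] at hG
  have h2 : ∫ x, (ofRiemannian h).gradSq f x ∂riemannianMeasure h =
      ∫ x, (ofRiemannian h).innerDual x (mvfderiv I f x).toLinearMap (mvfderiv I f x).toLinearMap
        ∂riemannianMeasure h := rfl
  linarith [h2]

/-- **The integrated Bochner formula on a closed Riemannian manifold**: for `u ∈ C^∞(N)`,

  `∫ |Hess u|²_h dμ_h + ∫ Ric(∇u, ∇u) dμ_h = ∫ (Δ_h u)² dμ_h`

(integrate `dalembertian_gradSq_eq`: `∫ Δ_h|∇u|² = 0` and `∫ h⁻¹(du, dΔ_h u) = −∫ (Δ_h u)²` by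
Green's identity), together with the integrability of both integrands. This is the identity by
which Lichnerowicz's estimate and Aubry's `L²`-estimates on `S_f = ∇f + f e` are obtained
(Aubry 2005, §2, Lemme 8–9). [cite: Aubry2005, §2, Lemme 8–9 (pp. 391–392)] -/
theorem integral_normSq_hessian_add_integral_ricci_eq {u : N → ℝ} (hu : CMDiff ∞ u) :
    Integrable (fun x ↦ (ofRiemannian h).normSq x ((ofRiemannian h).hessian u x))
        (riemannianMeasure h) ∧
      Integrable (fun x ↦ (ofRiemannian h).ricci x
          ((ofRiemannian h).sharp x (mvfderiv I u x : TangentSpace I x →ₗ[ℝ] ℝ))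
          ((ofRiemannian h).sharp x (mvfderiv I u x : TangentSpace I x →ₗ[ℝ] ℝ)))
        (riemannianMeasure h) ∧
      ∫ x, (ofRiemannian h).normSq x ((ofRiemannian h).hessian u x) ∂riemannianMeasure h
        + ∫ x, (ofRiemannian h).ricci x
            ((ofRiemannian h).sharp x (mvfderiv I u x : TangentSpace I x →ₗ[ℝ] ℝ))
            ((ofRiemannian h).sharp x (mvfderiv I u x : TangentSpace I x →ₗ[ℝ] ℝ))
            ∂riemannianMeasure h
        = ∫ x, ((ofRiemannian h).dalembertian u x) ^ 2 ∂riemannianMeasure h := by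
  -- the continuous functions involved
  have hQ : CMDiff ∞ ((ofRiemannian h).gradSq u) := contMDiff_gradSq _ hu
  have hL : CMDiff ∞ ((ofRiemannian h).dalembertian u) := contMDiff_dalembertian _ hu
  have hLQ : CMDiff ∞ ((ofRiemannian h).dalembertian ((ofRiemannian h).gradSq u)) :=
    contMDiff_dalembertian _ hQ
  have hN : CMDiff ∞ (fun y ↦ (ofRiemannian h).normSq y ((ofRiemannian h).hessian u y)) :=
    contMDiff_normSq_hessian _ hu
  have hP : CMDiff ∞ (fun y ↦ (ofRiemannian h).innerDual y
      (mvfderiv I u y : TangentSpace I y →ₗ[ℝ] ℝ)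
      (mvfderiv I ((ofRiemannian h).dalembertian u) y : TangentSpace I y →ₗ[ℝ] ℝ)) :=
    contMDiff_innerDual _ hu hL
  -- `Ric(∇u, ∇u)` as a combination of continuous functions (Bochner)
  have hRic_eq : (fun x ↦ (ofRiemannian h).ricci x
      ((ofRiemannian h).sharp x (mvfderiv I u x : TangentSpace I x →ₗ[ℝ] ℝ))
      ((ofRiemannian h).sharp x (mvfderiv I u x : TangentSpace I x →ₗ[ℝ] ℝ))) =
      fun x ↦ ((1 / 2) * (ofRiemannian h).dalembertian ((ofRiemannian h).gradSq u) x
        - (ofRiemannian h).normSq x ((ofRiemannian h).hessian u x))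
        - (ofRiemannian h).innerDual x (mvfderiv I u x : TangentSpace I x →ₗ[ℝ] ℝ)
          (mvfderiv I ((ofRiemannian h).dalembertian u) x : TangentSpace I x →ₗ[ℝ] ℝ) := by
    funext x
    have hB := dalembertian_gradSq_eq (ofRiemannian h) hu x
    linarith
  have iN : Integrable (fun x ↦ (ofRiemannian h).normSq x ((ofRiemannian h).hessian u x))
      (riemannianMeasure h) :=
    integrable_of_continuous h hN.continuous
  have iLQ : Integrable (fun x ↦ (ofRiemannian h).dalembertian ((ofRiemannian h).gradSq u) x)
      (riemannianMeasure h) :=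
    integrable_of_continuous h hLQ.continuous
  have iLQ' : Integrable (fun x ↦ (1 / 2) *
      (ofRiemannian h).dalembertian ((ofRiemannian h).gradSq u) x) (riemannianMeasure h) :=
    iLQ.const_mul _
  have iP : Integrable (fun y ↦ (ofRiemannian h).innerDual y
      (mvfderiv I u y : TangentSpace I y →ₗ[ℝ] ℝ)
      (mvfderiv I ((ofRiemannian h).dalembertian u) y : TangentSpace I y →ₗ[ℝ] ℝ))
      (riemannianMeasure h) :=
    integrable_of_continuous h hP.continuous
  have i12 : Integrable (fun x ↦ (1 / 2) *
      (ofRiemannian h).dalembertian ((ofRiemannian h).gradSq u) x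
        - (ofRiemannian h).normSq x ((ofRiemannian h).hessian u x)) (riemannianMeasure h) :=
    iLQ'.sub iN
  have iR : Integrable (fun x ↦ (ofRiemannian h).ricci x
      ((ofRiemannian h).sharp x (mvfderiv I u x : TangentSpace I x →ₗ[ℝ] ℝ))
      ((ofRiemannian h).sharp x (mvfderiv I u x : TangentSpace I x →ₗ[ℝ] ℝ)))
      (riemannianMeasure h) := by
    rw [hRic_eq]
    exact i12.sub iP
  refine ⟨iN, iR, ?_⟩
  -- `∫ Δ|∇u|² = 0` and `∫ h⁻¹(du, dΔu) = -∫ (Δu)²`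
  have h0 : ∫ x, (ofRiemannian h).dalembertian ((ofRiemannian h).gradSq u) x
      ∂riemannianMeasure h = 0 :=
    integral_dalembertian_eq_zero h (hQ.of_le (WithTop.coe_le_coe.mpr le_top))
  have hGreen : ∫ x, (ofRiemannian h).innerDual x (mvfderiv I u x : TangentSpace I x →ₗ[ℝ] ℝ)
      (mvfderiv I ((ofRiemannian h).dalembertian u) x : TangentSpace I x →ₗ[ℝ] ℝ)
        ∂riemannianMeasure h =
      -∫ x, ((ofRiemannian h).dalembertian u x) ^ 2 ∂riemannianMeasure h := by
    have hG := integral_mul_dalembertian_eq_neg_integral_innerDual h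
      (u := (ofRiemannian h).dalembertian u) (f := u) (hL.of_le (by exact_mod_cast le_top))
      (hu.of_le (WithTop.coe_le_coe.mpr le_top))
    have h1 : ∫ x, (ofRiemannian h).dalembertian u x * (ofRiemannian h).dalembertian u x
        ∂riemannianMeasure h =
        ∫ x, ((ofRiemannian h).dalembertian u x) ^ 2 ∂riemannianMeasure h :=
      integral_congr_ae (Eventually.of_forall fun x ↦ by simp [sq])
    rw [h1] at hG
    have h2 : ∫ x, (ofRiemannian h).innerDual x (mvfderiv I u x : TangentSpace I x →ₗ[ℝ] ℝ)
        (mvfderiv I ((ofRiemannian h).dalembertian u) x : TangentSpace I x →ₗ[ℝ] ℝ)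
          ∂riemannianMeasure h =
        ∫ x, (ofRiemannian h).innerDual x
          (mvfderiv I ((ofRiemannian h).dalembertian u) x).toLinearMap
          (mvfderiv I u x).toLinearMap ∂riemannianMeasure h :=
      integral_congr_ae (Eventually.of_forall fun x ↦ (ofRiemannian h).innerDual_comm x _ _)
    rw [h2]
    linarith
  rw [hRic_eq, integral_sub i12 iP, integral_sub iLQ' iN, integral_const_mul, h0, hGreen]
  ring

/-- Under `Ric ≥ (m-1) h` the curvature term of the integrated Bochner formula dominates the
Dirichlet energy: `(m-1) ∫ |∇u|² dμ_h ≤ ∫ Ric(∇u, ∇u) dμ_h` (`|∇u|² = h(♯du, ♯du)`).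
[cite: Aubry2005, §2, Lemme 9 (p. 392)] -/
theorem mul_integral_gradSq_le_integral_ricci
    (hRic : ∀ (x : N) (v : TangentSpace I x),
      ((m : ℝ) - 1) * h.inner x v v ≤ (ofRiemannian h).ricci x v v)
    {u : N → ℝ} (hu : CMDiff ∞ u) :
    ((m : ℝ) - 1) * ∫ x, (ofRiemannian h).gradSq u x ∂riemannianMeasure h ≤
      ∫ x, (ofRiemannian h).ricci x
        ((ofRiemannian h).sharp x (mvfderiv I u x : TangentSpace I x →ₗ[ℝ] ℝ))
        ((ofRiemannian h).sharp x (mvfderiv I u x : TangentSpace I x →ₗ[ℝ] ℝ))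
        ∂riemannianMeasure h := by
  obtain ⟨-, iR, -⟩ := integral_normSq_hessian_add_integral_ricci_eq h hu
  have iQ : Integrable (fun x ↦ (ofRiemannian h).gradSq u x) (riemannianMeasure h) :=
    integrable_of_continuous h (contMDiff_gradSq _ hu).continuous
  rw [← integral_const_mul]
  refine integral_mono (iQ.const_mul _) iR fun x ↦ ?_
  have hx := hRic x ((ofRiemannian h).sharp x (mvfderiv I u x : TangentSpace I x →ₗ[ℝ] ℝ))
  have hQ : (ofRiemannian h).gradSq u x =
      h.inner x ((ofRiemannian h).sharp x (mvfderiv I u x : TangentSpace I x →ₗ[ℝ] ℝ))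
        ((ofRiemannian h).sharp x (mvfderiv I u x : TangentSpace I x →ₗ[ℝ] ℝ)) := by
    rw [PseudoRiemannianMetric.gradSq, PseudoRiemannianMetric.innerDual_eq_val_sharp_sharp,
      val_ofRiemannian]
  dsimp only
  rw [hQ]
  exact hx

omit [I.Boundaryless] in
/-- For an eigenfunction, `∫ (Δ_h u)² dμ_h = μ² ∫ u² dμ_h`. [folklore] -/
theorem integral_dalembertian_sq_eq {u : N → ℝ} {μ : ℝ}
    (hΔ : ∀ x, (ofRiemannian h).dalembertian u x = -μ * u x) :
    ∫ x, ((ofRiemannian h).dalembertian u x) ^ 2 ∂riemannianMeasure h =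
      μ ^ 2 * ∫ x, u x ^ 2 ∂riemannianMeasure h := by
  rw [← integral_const_mul]
  refine integral_congr_ae (Eventually.of_forall fun x ↦ ?_)
  dsimp only
  rw [hΔ]
  ring

/-- **Lichnerowicz's eigenvalue estimate `λ₁ ≥ n`.** On a closed Riemannian `m`-manifold with
`Ric ≥ (m - 1) h`, `m ≥ 2`, every smooth eigenfunction `Δ_h u = −μ u`, `u ≢ 0` (`∫ u² > 0`), of
positive eigenvalue has `μ ≥ m`. Proof (Lichnerowicz, via the integrated Bochner formula
`integral_normSq_hessian_add_integral_ricci_eq`): `μ² ∫u² = ∫ (Δu)² = ∫ |Hess u|² + ∫ Ric(∇u, ∇u)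
≥ (1/m) ∫ (Δu)² + (m-1) ∫ |∇u|² = (μ²/m + (m-1) μ) ∫ u²` (`(tr_h T)² ≤ m |T|²`,
`trace_sq_le_finrank_mul_normSq`; `∫ |∇u|² = μ ∫ u²`), whence `μ (μ - m) ≥ 0`. This is the bound
`n ≤ λ₁` with which Aubry's §3 opens ("aux valeurs propres `n ≤ λ₁ ≤ ⋯ ≤ λₙ₊₁`", p. 395) and the
Poincaré step "Or `λ₁ ≥ n`" of the degree computation (p. 398); Lemme 9 (p. 392) is its analogue
for `1`-forms. [cite: Aubry2005, §3 (p. 395) and p. 398; Lemme 9 (p. 392)] -/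
theorem lichnerowicz_le_eigenvalue (hm : 2 ≤ m)
    (hRic : ∀ (x : N) (v : TangentSpace I x),
      ((m : ℝ) - 1) * h.inner x v v ≤ (ofRiemannian h).ricci x v v)
    {u : N → ℝ} {μ : ℝ} (hu : CMDiff ∞ u)
    (hΔ : ∀ x, (ofRiemannian h).dalembertian u x = -μ * u x) (hμ : 0 < μ)
    (hu0 : 0 < ∫ x, u x ^ 2 ∂riemannianMeasure h) :
    (m : ℝ) ≤ μ := by
  obtain ⟨iN, iR, hB⟩ := integral_normSq_hessian_add_integral_ricci_eq h hu
  have hR := mul_integral_gradSq_le_integral_ricci h hRic hu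
  rw [integral_gradSq_eq_of_dalembertian_eq h (hu.of_le (WithTop.coe_le_coe.mpr le_top)) hΔ] at hR
  rw [integral_dalembertian_sq_eq h hΔ] at hB
  -- `∫ |Hess u|² ≥ (1/m) ∫ (Δu)² = μ²/m ∫ u²`
  have hm0 : (0 : ℝ) < m := by exact_mod_cast (lt_of_lt_of_le (by norm_num) hm)
  have hH : μ ^ 2 * ∫ x, u x ^ 2 ∂riemannianMeasure h ≤
      m * ∫ x, (ofRiemannian h).normSq x ((ofRiemannian h).hessian u x) ∂riemannianMeasure h := by
    rw [← integral_dalembertian_sq_eq h hΔ, ← integral_const_mul]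
    refine integral_mono ?_ (iN.const_mul _) fun x ↦ ?_
    · exact integrable_of_continuous h ((contMDiff_dalembertian _ hu).continuous.pow 2)
    · have hcs := (ofRiemannian h).trace_sq_le_finrank_mul_normSq x (isRiemannian_ofRiemannian h)
        ((ofRiemannian h).hessian u x)
      rw [finrank_euclideanSpace_fin] at hcs
      exact hcs
  -- combine: `m μ² S ≤ μ² S + m (μ² S - (m-1) μ S)`... i.e. `μ (μ - m) S ≥ 0`
  set S := ∫ x, u x ^ 2 ∂riemannianMeasure h with hS
  have key : (m : ℝ) * ((m - 1) * (μ * S)) ≤ (m - 1) * (μ ^ 2 * S) := by nlinarith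
  have h1 : (0 : ℝ) < (m - 1) * (μ * S) := by
    have : (1 : ℝ) < m := by exact_mod_cast (lt_of_lt_of_le (by norm_num) hm)
    positivity
  nlinarith

/-- **Aubry's `L²`-estimate on `S_u = ∇u + u e` (Lemme 8 integrated; the first inequality of
Prop. 10 (ii)).** On a closed Riemannian `m`-manifold with `Ric ≥ (m - 1) h`, a smooth
eigenfunction `Δ_h u = −μ u` satisfies

  `∫ |Hess u + u h|²_h dμ_h ≤ (μ - m)(μ - 1) ∫ u² dμ_h`,

the integrand being integrable (indeed continuous). In the language of Aubry's §2 (Ruh's bundle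
`E = TM ⊕ ℝe`, `S_u = ∇u + u e`, `D^E_Z S_u = ∇_Z ∇u + u Z`, so `|D^E S_u|² = |Hess u + u g|²`) this
is `‖D^E S_u‖₂² ≤ (λ - n)(λ - 1)‖u‖₂²`, i.e. `‖D^E S‖₂² ≤ (λ - n)‖AS‖… ≤ λ_k(Δ^E)‖S‖₂²` with
`λ_k(Δ^E) ≤ λ_k(M) − n` (Lemme 8: `Δ^E_sph S_f = (λ - n) A S_f`, and Prop. 10 (ii)); it is the
estimate "`‖D^E Sᵢ‖₂² ≤ C(n) ε`" invoked in the degree computation (p. 398) and in Lemme 18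
(p. 401). Proof: `|Hess u + u h|² = |Hess u|² + 2u Δu + m u²` (`normSq_add_smul_toBilinForm`),
`∫ |Hess u|² = μ² ∫u² − ∫ Ric(∇u,∇u) ≤ μ² ∫u² − (m-1) μ ∫u²` (integrated Bochner formula and
`Ric ≥ m - 1`), and `∫ 2uΔu + m u² = (m - 2μ) ∫ u²`.
[cite: Aubry2005, §2, Lemme 8 (p. 391) and Prop. 10 (ii) (pp. 392–393)] -/
theorem aubry_integral_normSq_hessian_add_smul_le
    (hRic : ∀ (x : N) (v : TangentSpace I x),
      ((m : ℝ) - 1) * h.inner x v v ≤ (ofRiemannian h).ricci x v v)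
    {u : N → ℝ} {μ : ℝ} (hu : CMDiff ∞ u)
    (hΔ : ∀ x, (ofRiemannian h).dalembertian u x = -μ * u x) :
    Integrable (fun x ↦ (ofRiemannian h).normSq x
        ((ofRiemannian h).hessian u x + u x • (ofRiemannian h).toBilinForm x))
        (riemannianMeasure h) ∧
      ∫ x, (ofRiemannian h).normSq x
          ((ofRiemannian h).hessian u x + u x • (ofRiemannian h).toBilinForm x)
          ∂riemannianMeasure h ≤
        (μ - m) * (μ - 1) * ∫ x, u x ^ 2 ∂riemannianMeasure h := by
  obtain ⟨iN, iR, hB⟩ := integral_normSq_hessian_add_integral_ricci_eq h hu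
  have hR := mul_integral_gradSq_le_integral_ricci h hRic hu
  rw [integral_gradSq_eq_of_dalembertian_eq h (hu.of_le (WithTop.coe_le_coe.mpr le_top)) hΔ] at hR
  rw [integral_dalembertian_sq_eq h hΔ] at hB
  -- pointwise expansion of the integrand
  have hpt : ∀ x, (ofRiemannian h).normSq x
      ((ofRiemannian h).hessian u x + u x • (ofRiemannian h).toBilinForm x) =
      (ofRiemannian h).normSq x ((ofRiemannian h).hessian u x) + ((m : ℝ) - 2 * μ) * u x ^ 2 := by
    intro x
    have hs : ∀ v w, (ofRiemannian h).hessian u x v w = (ofRiemannian h).hessian u x w v :=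
      fun v w ↦ ((ofRiemannian h).hessian_symm_holds
        ((hu.of_le (WithTop.coe_le_coe.mpr le_top)).contMDiffAt)).eq v w
    rw [(ofRiemannian h).normSq_add_smul_toBilinForm x hs (u x), finrank_euclideanSpace_fin]
    change _ + 2 * u x * (ofRiemannian h).dalembertian u x + _ = _
    rw [hΔ]
    ring
  have hfun : (fun x ↦ (ofRiemannian h).normSq x
      ((ofRiemannian h).hessian u x + u x • (ofRiemannian h).toBilinForm x)) =
      fun x ↦ (ofRiemannian h).normSq x ((ofRiemannian h).hessian u x)
        + ((m : ℝ) - 2 * μ) * u x ^ 2 := funext hpt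
  have iu2 : Integrable (fun x ↦ u x ^ 2) (riemannianMeasure h) :=
    integrable_of_continuous h (hu.continuous.pow 2)
  rw [hfun]
  refine ⟨iN.add (iu2.const_mul _), ?_⟩
  rw [integral_add iN (iu2.const_mul _), integral_const_mul]
  nlinarith

end Integrated

/-! ### Layer 1 of the printed proof in the vocabulary of the named fact -/

section FactLevel

/-- **The `L²`-theory of one pinched eigenfunction, in the vocabulary of
`aubry_diffeomorph_sphere_of_eigenvalue_pinching`.** Let `(M, g)` be a closed Riemannian
`n`-manifold, `n ≥ 2`, with `Ric ≥ (n-1) g`, and `f` a smooth `L²(dv_g)`-normalised eigenfunction,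
`tr_g Hess f = −μ f` with `0 < μ ≤ n + ε`. Then

* `∫ f dv_g = 0` (Aubry 2005, p. 392);
* `n ≤ μ` (Lichnerowicz; so the hypothesis `μᵢ ≤ n + ε` of the fact is the two-sided pinching
  `n ≤ μᵢ ≤ n + ε` of Aubry's §3, p. 395);
* `∫ |Hess f + f g|²_g dv_g ≤ ε (n + ε − 1)` — the section `S_f = ∇f + f e` of `TM ⊕ ℝe` is
  almost parallel in `L²` (Lemme 8 / Prop. 10 (ii); the input "`‖D^E Sᵢ‖₂² ≤ C(n) ε`" of the
  degree computation p. 398 and of Lemme 18, p. 401).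

This is the first layer of the printed proof of Théorème 1; the `L^∞` layer (Lemme 11, Moser
iteration with Ilias' Sobolev constant), Prop. 12 (degree of the eigenmap, Bishop–Gromov) and
Prop. 19 are not formalised here. [cite: Aubry2005, §2, Lemme 8, Prop. 10 (ii) (pp. 391–393); §3 p. 395; p. 398] -/
theorem aubry_eigenfunction_estimates (n : ℕ) (hn : 2 ≤ n) (ε : ℝ)
    (M : Type*) [TopologicalSpace M] [T2Space M]
    [ChartedSpace (EuclideanSpace ℝ (Fin n)) M] [IsManifold (𝓡 n) ∞ M] [CompactSpace M]
    [MeasurableSpace M] [BorelSpace M]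
    (g : Bundle.ContMDiffRiemannianMetric (𝓡 n) ∞ (EuclideanSpace ℝ (Fin n))
      (TangentSpace (𝓡 n) : M → Type _))
    (hLC : (ofRiemannian g).HasLeviCivita) (f : M → ℝ) (μ : ℝ)
    (hRic : ∀ (x : M) (v : TangentSpace (𝓡 n) x),
        ((n : ℝ) - 1) * g.inner x v v ≤ (ofRiemannian g).ricci x v v)
    (hf : ContMDiff (𝓡 n) 𝓘(ℝ, ℝ) ∞ f)
    (hΔ : ∀ x : M, (ofRiemannian g).dalembertian f x = -μ * f x)
    (hμ : 0 < μ ∧ μ ≤ n + ε)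
    (hnorm : ∫ x, f x * f x ∂(riemannianMeasure g) = 1) :
    ∫ x, f x ∂(riemannianMeasure g) = 0 ∧ (n : ℝ) ≤ μ ∧
      ∫ x, (ofRiemannian g).normSq x
          ((ofRiemannian g).hessian f x + f x • (ofRiemannian g).toBilinForm x)
          ∂(riemannianMeasure g) ≤ ε * (n + ε - 1) := by
  haveI := hLC
  have hsq : ∫ x, f x ^ 2 ∂(riemannianMeasure g) = 1 := by
    rw [← hnorm]
    exact integral_congr_ae (Eventually.of_forall fun x ↦ by simp [sq])
  have h0 := integral_eq_zero_of_dalembertian_eq g (hf.of_le (WithTop.coe_le_coe.mpr le_top)) hΔ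
    hμ.1.ne'
  have hL := lichnerowicz_le_eigenvalue g hn hRic hf hΔ hμ.1 (by rw [hsq]; exact one_pos)
  refine ⟨h0, hL, ?_⟩
  have hA := (aubry_integral_normSq_hessian_add_smul_le g hRic hf hΔ).2
  rw [hsq, mul_one] at hA
  refine hA.trans ?_
  have h1 : (1 : ℝ) < n := by exact_mod_cast (lt_of_lt_of_le (by norm_num) hn)
  nlinarith [hμ.1, hμ.2, hL, h1]

/-- **`L²`-orthogonality of the sections `Sᵢ = ∇fᵢ + fᵢ e`** (Aubry 2005, p. 394: "la famille de
sections `(Sᵢ/√(λᵢ+1))` est `L²`-orthonormée"): for smooth eigenfunctions `tr_g Hess fᵢ = −μᵢ fᵢ`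
that are `L²(dv_g)`-orthonormal, `⟨Sᵢ, Sⱼ⟩_{L²} = ∫ (g⁻¹(dfᵢ, dfⱼ) + fᵢ fⱼ) dv_g = (μⱼ + 1) δᵢⱼ`
(Green's identity `∫ fᵢ Δfⱼ = −∫ g⁻¹(dfᵢ, dfⱼ)`), in the binders of the named fact.
[cite: Aubry2005, §2, proof of Lemme 11 (p. 394)] -/
theorem aubry_sections_L2_orthogonal (n : ℕ)
    (M : Type*) [TopologicalSpace M] [T2Space M]
    [ChartedSpace (EuclideanSpace ℝ (Fin n)) M] [IsManifold (𝓡 n) ∞ M] [CompactSpace M]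
    [MeasurableSpace M] [BorelSpace M]
    (g : Bundle.ContMDiffRiemannianMetric (𝓡 n) ∞ (EuclideanSpace ℝ (Fin n))
      (TangentSpace (𝓡 n) : M → Type _))
    (hLC : (ofRiemannian g).HasLeviCivita) (f : Fin n → M → ℝ) (μ : Fin n → ℝ)
    (hf : ∀ i, ContMDiff (𝓡 n) 𝓘(ℝ, ℝ) ∞ (f i))
    (hΔ : ∀ (i : Fin n) (x : M), (ofRiemannian g).dalembertian (f i) x = -(μ i) * f i x)
    (horth : ∀ i j, ∫ x, f i x * f j x ∂(riemannianMeasure g) = if i = j then 1 else 0)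
    (i j : Fin n) :
    ∫ x, ((ofRiemannian g).innerDual x
        (mvfderiv (𝓡 n) (f i) x : TangentSpace (𝓡 n) x →ₗ[ℝ] ℝ)
        (mvfderiv (𝓡 n) (f j) x : TangentSpace (𝓡 n) x →ₗ[ℝ] ℝ) + f i x * f j x)
        ∂(riemannianMeasure g) = if i = j then μ j + 1 else 0 := by
  haveI := hLC
  have h2 : (2 : ℕ∞ω) ≤ ∞ := WithTop.coe_le_coe.mpr le_top
  have hG := integral_mul_dalembertian_eq_neg_integral_innerDual g (u := f i) (f := f j)
    ((hf i).of_le (by exact_mod_cast le_top)) ((hf j).of_le h2)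
  simp_rw [hΔ j] at hG
  have h1 : ∫ x, f i x * (-μ j * f j x) ∂riemannianMeasure g =
      -μ j * ∫ x, f i x * f j x ∂riemannianMeasure g := by
    rw [← integral_const_mul]
    exact integral_congr_ae (Eventually.of_forall fun x ↦ by ring)
  rw [h1, horth i j] at hG
  have iP : Integrable (fun x ↦ (ofRiemannian g).innerDual x
      (mvfderiv (𝓡 n) (f i) x : TangentSpace (𝓡 n) x →ₗ[ℝ] ℝ)
      (mvfderiv (𝓡 n) (f j) x : TangentSpace (𝓡 n) x →ₗ[ℝ] ℝ)) (riemannianMeasure g) :=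
    integrable_of_continuous g (contMDiff_innerDual _ (hf i) (hf j)).continuous
  have iff' : Integrable (fun x ↦ f i x * f j x) (riemannianMeasure g) :=
    integrable_of_continuous g ((hf i).continuous.mul (hf j).continuous)
  rw [integral_add iP iff', horth i j]
  have hP : ∫ x, (ofRiemannian g).innerDual x
      (mvfderiv (𝓡 n) (f i) x : TangentSpace (𝓡 n) x →ₗ[ℝ] ℝ)
      (mvfderiv (𝓡 n) (f j) x : TangentSpace (𝓡 n) x →ₗ[ℝ] ℝ) ∂riemannianMeasure g =
      -(if i = j then (1 : ℝ) else 0) * -μ j := by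
    have : ∫ x, (ofRiemannian g).innerDual x
        (mvfderiv (𝓡 n) (f i) x : TangentSpace (𝓡 n) x →ₗ[ℝ] ℝ)
        (mvfderiv (𝓡 n) (f j) x : TangentSpace (𝓡 n) x →ₗ[ℝ] ℝ) ∂riemannianMeasure g =
        ∫ x, (ofRiemannian g).innerDual x (mvfderiv (𝓡 n) (f i) x).toLinearMap
          (mvfderiv (𝓡 n) (f j) x).toLinearMap ∂riemannianMeasure g := rfl
    rw [this]
    linarith
  rw [hP]
  split_ifs <;> ring

end FactLevel

/-! ### The closing arithmetic of Proposition 12 -/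

section DegreeArithmetic

/-- **The last step of the proof of Aubry's Proposition 12** (p. 398: "Comme `deg Φ` est un
entier et que `Vol M ≤ Vol Sⁿ`, on obtient `deg Φ = ±1` et `Vol M ≥ Vol Sⁿ (1 − C(n) ε^{…})`"):
if an integer `d` (the degree of the eigenmap `Φ : M → Sⁿ`) and volumes `0 < V ≤ V₀`
(`V = Vol M`, `V₀ = Vol Sⁿ`, Bishop's bound) satisfy `| |d| V₀ / V − 1 | ≤ η` with `η < 1`, then
`|d| = 1` and `V₀ ≤ (1 + η) V` (so `V ≥ (1 − η) V₀`). [cite: Aubry2005, §3, end of the proof of Prop. 12 (p. 398)] -/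
theorem aubry_abs_degree_eq_one_of_volume {d : ℤ} {V V₀ η : ℝ} (hV : 0 < V) (hVV₀ : V ≤ V₀)
    (hη : η < 1) (h : |(|d| : ℝ) * V₀ / V - 1| ≤ η) :
    |d| = 1 ∧ V₀ ≤ (1 + η) * V := by
  have hV₀ : 0 < V₀ := hV.trans_le hVV₀
  obtain ⟨hlo, hhi⟩ := abs_sub_le_iff.1 h
  -- clear the denominator: `1 - η ≤ |d| V₀ / V ≤ 1 + η`
  have hmul : (|d| : ℝ) * V₀ / V * V = (|d| : ℝ) * V₀ := div_mul_cancel₀ _ hV.ne'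
  have hlo' : (1 - η) * V ≤ (|d| : ℝ) * V₀ := by nlinarith
  have hhi' : (|d| : ℝ) * V₀ ≤ (1 + η) * V := by nlinarith
  have hd0 : (d : ℝ) ≠ 0 := by
    intro h0
    rw [h0, abs_zero, zero_mul] at hlo'
    nlinarith
  have hd_ne : d ≠ 0 := by exact_mod_cast hd0
  have hd2 : (|d| : ℝ) < 2 := by
    by_contra hge
    push Not at hge
    nlinarith
  have habs : |d| = 1 := by
    have h1 : ((|d| : ℤ) : ℝ) < 2 := by rw [Int.cast_abs]; exact hd2
    have h1' : |d| < 2 := by exact_mod_cast h1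
    have h2 : 1 ≤ |d| := Int.one_le_abs hd_ne
    omega
  refine ⟨habs, ?_⟩
  have h1 : (|d| : ℝ) = 1 := by
    have h' := congrArg (fun z : ℤ ↦ (z : ℝ)) habs
    simpa [Int.cast_abs] using h'
  rw [h1, one_mul] at hhi'
  exact hhi'

end DegreeArithmetic

/-! ### The rank argument of Prop. 10 (i): almost-orthonormal families are free -/

section RankArgument

open Finset

/-- **Almost-orthonormal families are linearly independent** (the rank argument of Aubry 2005,
end of §2, p. 395: "il existe au moins un point `x` de `M_ε` où la famille `(Sᵢ(x))_{1≤i≤n+2}`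
est de rang `n + 2`, ce qui est impossible car `E` est de rang `n + 1`"). If `k` vectors `Sᵢ`
of a real vector space satisfy `|B(Sᵢ, Sⱼ) − δᵢⱼ| ≤ η` for some bilinear form `B` with `k η < 1`,
they are linearly independent: if `Σ cⱼ Sⱼ = 0` and `|cᵢ|` is maximal, pairing with `Sᵢ` gives
`|cᵢ| (1 − η) ≤ |cᵢ| B(Sᵢ, Sᵢ) ≤ Σ_{j ≠ i} |cⱼ| |B(Sᵢ, Sⱼ)| ≤ |cᵢ| (k − 1) η`. (No symmetry or
positivity of `B` is needed.) [cite: Aubry2005, §2, end of the proof of Lemme 11 (p. 395)] -/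
theorem linearIndependent_of_abs_bilin_sub_delta_le {V : Type*} [AddCommGroup V] [Module ℝ V]
    (B : V →ₗ[ℝ] V →ₗ[ℝ] ℝ) {k : ℕ} (S : Fin k → V) {η : ℝ} (hη : k * η < 1)
    (h : ∀ i j, |B (S i) (S j) - (if i = j then 1 else 0)| ≤ η) :
    LinearIndependent ℝ S := by
  rw [Fintype.linearIndependent_iff]
  intro c hc
  by_contra hne
  push Not at hne
  -- an index maximising `|c i|`
  obtain ⟨i, -, hi⟩ := exists_max_image (univ : Finset (Fin k)) (fun i ↦ |c i|)
    (univ_nonempty_iff.2 (by obtain ⟨i, _⟩ := hne; exact ⟨i⟩))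
  obtain ⟨i₀, hi₀⟩ := hne
  have hci : 0 < |c i| := (abs_pos.2 hi₀).trans_le (hi i₀ (mem_univ _))
  have hη0 : 0 ≤ η := (abs_nonneg _).trans (h i i)
  -- pair the relation with `S i`
  have hsum : ∑ j, c j * B (S i) (S j) = 0 := by
    have := congrArg (fun v ↦ B (S i) v) hc
    simpa [map_sum, map_smul, smul_eq_mul] using this
  -- the diagonal term against the others
  have hdiag : 1 - η ≤ B (S i) (S i) := by
    have := h i i
    rw [if_pos rfl] at this
    linarith [abs_sub_le_iff.1 this]
  have hoff : ∀ j, j ≠ i → |B (S i) (S j)| ≤ η := fun j hj ↦ by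
    have := h i j
    rwa [if_neg (Ne.symm hj), sub_zero] at this
  have hsplit : c i * B (S i) (S i) = -∑ j ∈ univ.erase i, c j * B (S i) (S j) := by
    rw [← Finset.add_sum_erase _ _ (mem_univ i)] at hsum
    linarith
  have hbound : |c i| * (1 - η) ≤ |c i| * ((k - 1 : ℝ) * η) := by
    calc |c i| * (1 - η) ≤ |c i| * B (S i) (S i) := by gcongr
      _ ≤ |c i * B (S i) (S i)| := by rw [abs_mul]; exact mul_le_mul_of_nonneg_left (le_abs_self _) (abs_nonneg _)
      _ = |∑ j ∈ univ.erase i, c j * B (S i) (S j)| := by rw [hsplit, abs_neg]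
      _ ≤ ∑ j ∈ univ.erase i, |c j * B (S i) (S j)| := abs_sum_le_sum_abs _ _
      _ ≤ ∑ j ∈ univ.erase i, |c i| * η := by
          refine sum_le_sum fun j hj ↦ ?_
          rw [abs_mul]
          exact mul_le_mul (hi j (mem_univ _)) (hoff j (ne_of_mem_erase hj)) (abs_nonneg _)
            (abs_nonneg _)
      _ = |c i| * ((k - 1 : ℝ) * η) := by
          rw [sum_const, card_erase_of_mem (mem_univ i), card_univ, Fintype.card_fin, nsmul_eq_mul]
          have hk : 1 ≤ k := Nat.one_le_iff_ne_zero.2 (by rintro rfl; exact Fin.elim0 i)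
          push_cast [Nat.cast_sub hk]
          ring
  have h1 : 1 - η ≤ (k - 1 : ℝ) * η := le_of_mul_le_mul_left hbound hci
  nlinarith

/-- Hence **at most `dim V` almost-orthonormal vectors**: under the hypotheses of
`linearIndependent_of_abs_bilin_sub_delta_le` in a finite-dimensional space, `k ≤ dim V` — for
Aubry, no `n + 2` sections of the rank-`(n+1)` bundle `E = TM ⊕ ℝe` can be pointwise almost
orthonormal (Prop. 10 (i), p. 395). [cite: Aubry2005, §2, Prop. 10 (i) via Lemme 11 (p. 395)] -/
theorem card_le_finrank_of_abs_bilin_sub_delta_le {V : Type*} [AddCommGroup V] [Module ℝ V]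
    [Module.Finite ℝ V] (B : V →ₗ[ℝ] V →ₗ[ℝ] ℝ) {k : ℕ} (S : Fin k → V) {η : ℝ} (hη : k * η < 1)
    (h : ∀ i j, |B (S i) (S j) - (if i = j then 1 else 0)| ≤ η) :
    k ≤ Module.finrank ℝ V := by
  simpa using LinearIndependent.fintype_card_le_finrank
    (linearIndependent_of_abs_bilin_sub_delta_le B S hη h)

end RankArgument


end Literature.Geometry.Riemannian

end
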